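/-
Copyright (c) 2026. All rights reserved.
Released under Apache 2.0 license as described in the file LICENSE.
Authors: abc-iut cell, campaign-S prover seat abc-iut-S1 (wave 1).
-/
import Mathlib.NumberTheory.Padics.ProperSpace
import Literature.NumberTheory.GaloisRepresentations.PadicResidueIndex
import Literature.NumberTheory.GaloisRepresentations.PadicAlgClFiniteSubextensionDvr
import Literature.IUT.LogVolume.LocalUnitLog
import Literature.IUT.LogVolume.RamificationInvariants
import HarnessLib

/-!
# The literal setting of [IUTchIV] §1: finite extensions `k_i ⊆ ℚ̄_p` of `ℚ_p`, and `ℚ_p` itself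

[IUTchIV] Prop. 1.1 (kurims p. 9): "`ℚ̄_p` an algebraic closure of `ℚ_p` … for `i ∈ I`, let `k_i ⊆ ℚ̄_p` be a
finite extension of `ℚ_p`".  The cell's files type `k_i` as an ABSTRACT field `K` with
`[NontriviallyNormedField K] [NormedAlgebra ℚ_[p] K] [IsUltrametricDist K] [ProperSpace K]`.  This file
closes the loop:

* for `E : IntermediateField ℚ_[p] (PadicAlgCl p)` (Mathlib's `ℚ̄_p` with its spectral `p`-adic norm),
  finite over `ℚ_p`, the SCOPED instance `ProperSpace E` (`FiniteDimensional.proper`; absent from Mathlib)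
  — Mathlib already provides `NontriviallyNormedField E` (`IntermediateField.instNontriviallyNormedField…`,
  `Mathlib.Analysis.Normed.Algebra.Basic`), `NormedAlgebra ℚ_[p] E` and `IsUltrametricDist E` — so every
  `k_i ⊆ ℚ̄_p` IS an instance of the setting (`setting_subfield`);
* `coe_unitLog_eq_padicLogAlgCl` — on units of `E` the cell's `log_p` (`unitLog`, `LocalUnitLog.lean`)
  AGREES with the tree's Iwasawa logarithm of `ℚ̄_p` (`Literature.NumberTheory.Transcendental.padicLogAlgCl`);
* non-vacuity / calibration at `K = ℚ_p`: `absRamificationIdx p ℚ_[p] = 1`, `residueDegree p ℚ_[p] = 1`.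

Classical; nothing disputed.
-/

noncomputable section

open Metric Set IsLocalRing
open scoped NormedField

namespace Literature.IUT.LogVolume

open Literature.NumberTheory.Transcendental Literature.NumberTheory.GaloisRepresentations.Ultrametric

variable (p : ℕ) [Fact p.Prime]

/-! ## Finite extensions of `ℚ_p` inside `ℚ̄_p` are instances of the setting -/

section Subfield

variable (E : IntermediateField ℚ_[p] (PadicAlgCl p))

/-- **A finite `E ⊆ ℚ̄_p` is proper** (locally compact; Riesz), scoped instance.
[claim: Mochizuki2012, status: disputed] -/
scoped instance properSpace_subfield [FiniteDimensional ℚ_[p] E] : ProperSpace E :=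
  FiniteDimensional.proper ℚ_[p] E

/-- So a finite `k_i ⊆ ℚ̄_p` carries the whole setting of the cell's [IUTchIV] §1 files (all four instances
found by inference: three from Mathlib, `ProperSpace` from `properSpace_subfield`).
[claim: Mochizuki2012, status: disputed] -/
theorem setting_subfield [FiniteDimensional ℚ_[p] E] :
    Nonempty (NontriviallyNormedField E) ∧ Nonempty (NormedAlgebra ℚ_[p] E) ∧
      IsUltrametricDist E ∧ ProperSpace E :=
  ⟨⟨inferInstance⟩, ⟨inferInstance⟩, inferInstance, inferInstance⟩

/-- **Compatibility of the logarithms**: for a unit `u` of a finite `E ⊆ ℚ̄_p`, the cell's `log_p u`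
(computed in `E`) is the Iwasawa logarithm of `u` in `ℚ̄_p` (the tree's `padicLogAlgCl`): both are
`k⁻¹·L(uᵏ)` for a principal-unit power `uᵏ`, and the series computed in the complete field `E` sums to the
same value in `ℚ̄_p` (`IwasawaLog.hasSum_logSeries_coe`). [claim: Mochizuki2012, status: disputed] -/
theorem coe_unitLog_eq_padicLogAlgCl [FiniteDimensional ℚ_[p] E] {u : E} (hu : ‖u‖ = 1) :
    ((unitLog u : E) : PadicAlgCl p) = padicLogAlgCl p (u : PadicAlgCl p) := by
  obtain ⟨k, hk, hkP⟩ := exists_pow_isPrincipal hu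
  -- the cell's side
  rw [unitLog_eq_inv_mul_logSeries p hk hkP]
  -- the `ℚ̄_p` side: `(k, 0)` normalises `u`
  have hnorm : IsLogNormalizer p (u : PadicAlgCl p) (k, 0) := by
    refine ⟨hk, ?_⟩
    dsimp only
    rw [zpow_zero, mul_one]
    have : ‖(1 : E) - u ^ k‖ < 1 := hkP
    simpa [Literature.NumberTheory.GaloisRepresentations.PadicAlgCl.norm_coe E] using this
  rw [IwasawaLog.log_eq_of_isLogNormalizer hnorm]
  dsimp only
  rw [zpow_zero, mul_one]
  -- the series agree
  have hsum := IwasawaLog.hasSum_logSeries_coe E (u ^ k) (by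
    have : ‖(1 : E) - u ^ k‖ < 1 := hkP
    simpa [Literature.NumberTheory.GaloisRepresentations.PadicAlgCl.norm_coe E] using this)
  have hL : padicLogSeriesAlgCl p ((u : PadicAlgCl p) ^ k) = ((logSeries (u ^ k) : E) : PadicAlgCl p) := by
    unfold padicLogSeriesAlgCl logSeries
    have := hsum.tsum_eq
    push_cast at this ⊢
    exact this
  rw [hL]
  push_cast
  rfl

end Subfield

/-! ## Calibration at `K = ℚ_p`: `e = f = 1` -/

/-- **`e(ℚ_p/ℚ_p) = 1`** (`p` is a norm uniformizer of `ℚ_p`). [claim: Mochizuki2012, status: disputed] -/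
theorem absRamificationIdx_padic : absRamificationIdx p ℚ_[p] = 1 := by
  have h := norm_prime_eq_norm_pow p ℚ_[p] (PadicUniformizer.isUniformizer_varpi p)
  rw [PadicUniformizer.varpi_val] at h
  have hp0 : 0 < ‖(p : ℚ_[p])‖ := PadicUniformizer.norm_p_pos' p
  have hp1 : ‖(p : ℚ_[p])‖ < 1 := PadicUniformizer.norm_p_lt_one' p
  have : ‖(p : ℚ_[p])‖ ^ 1 = ‖(p : ℚ_[p])‖ ^ absRamificationIdx p ℚ_[p] := by rw [pow_one]; exact h
  exact (pow_right_injective₀ hp0 hp1.ne this).symm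

/-- **`f(ℚ_p/ℚ_p) = 1`** (`#(ℤ_p/pℤ_p) = p`). [claim: Mochizuki2012, status: disputed] -/
theorem residueDegree_padic : residueDegree p ℚ_[p] = 1 := by
  have hp : p.Prime := Fact.out
  have hcard := card_residueField p ℚ_[p]
  rw [← (PadicUniformizer.isUniformizer_varpi p).resIndex_eq_card_residueField,
    PadicUniformizer.resIndex_padic] at hcard
  have : p ^ 1 = p ^ residueDegree p ℚ_[p] := by rw [pow_one]; exact hcard
  exact (Nat.pow_right_injective hp.two_le this).symm

end Literature.IUT.LogVolume

end
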